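import Literature.Probability.Percolation.Percolation
import HarnessLib

/-!
# Bundling a large open cluster into many disjoint connected witnesses

Topic `Literature/Probability/Percolation`. Combinatorial core of the **universal tightness
theorem** for the maximum cluster size (Hutchcroft, PTRF 181 (2021), Thm. 2.2/2.3), which enters
Hutchcroft's 2022 hierarchical bounds for long-range percolation (J. Math. Phys. 63 (2022), §2.2,
(2.5)–(2.7)). Hutchcroft's Thm. 2.3 rests on a divide-and-conquer lemma (2021, Lemma 2.4: a
locally finite tree carrying a finite set `A` with `|A| ≥ 3^k` splits into `≥ 3^{k-1}+1` disjoint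
connected edge sets each meeting `A` in a fraction `∈ [3^{-k}, 3^{-k+1})`), whose disjoint pieces
serve as BK witnesses: "the sets `E_1, …, E_m` are all witnesses for the event
`{|K_max(Λ)| ≥ λ}`, and since these sets are all disjoint we deduce that
`{|K_max(Λ)| ≥ 3^k λ} ⊆ {|K_max(Λ)| ≥ λ} ∘ ⋯ ∘ {|K_max(Λ)| ≥ λ}` (`3^{k-1}+1` copies)" (2021, proof
of Thm. 2.3, p. 13).

We obtain the same kind of witnesses by a shorter (linear rather than `3`-adic) route with
slightly different constants, which is all that the applications use: order the relevant finite
part of the cluster so that every vertex after the first has an earlier neighbour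
(`exists_adjacent_ordering`), fix such a parent for each vertex, and peel the resulting parent
forest leaf by leaf, emitting a bundle as soon as the accumulated number of `Λ`-vertices reaches
`t` (`bundling_aux`, `exists_bundling`: at least `(|A|+1-t)/(2t-1)` bundles, pairwise disjoint off
their roots, each with `≥ t` marked vertices, the first rooted at the starting vertex). The
parent edges of the bundles are then pairwise disjoint open witnesses
(`exists_disjoint_cluster_witnesses`): **if the open cluster of `x` meets `Λ` in at least
`(2N+1)t` vertices then there are `N+1` pairwise disjoint finite sets of open edges each of which
alone connects `≥ t` vertices of `Λ`, the first of them to `x`.** Consequently (next file, with the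
BK inequality) `P(|K_max(Λ)| ≥ (2N+1)t) ≤ P(|K_max(Λ)| ≥ t)^{N+1}` and
`P(|K_u ∩ Λ| ≥ (2N+1)t) ≤ P(|K_u ∩ Λ| ≥ t) P(|K_max(Λ)| ≥ t)^N`, which contain Hutchcroft's
(2021) Thm. 2.3 for integer `λ` (take `2N+1 = 3^k`; `(3^k+1)/2 ≥ 3^{k-1}+1`).

## References

* [Hutchcroft2021] T. Hutchcroft, *Power-law bounds for critical long-range percolation below the
  upper-critical dimension*, Probab. Theory Related Fields 181 (2021) 533–570, arXiv:2008.11197: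
  §2.1, Thm. 2.2, Thm. 2.3, Lemma 2.4 and the proof of Thm. 2.3 (pp. 11–13).
* [Hutchcroft2022] T. Hutchcroft, *Sharp hierarchical upper bounds on the critical two-point
  function for long-range percolation on `ℤ^d`*, J. Math. Phys. 63 (2022), arXiv:2202.07634,
  §2.2 (2.5)–(2.7).
-/

namespace Literature.Probability.Percolation

open Finset

/-! ### The leaf-peeling bundling process on a parent forest -/

/-- **Bundling invariant** of the leaf-peeling process (auxiliary; see `exists_bundling`). The
vertices `0, …, n-1` carry a parent map `par` with `par i < i`; after processing the vertices
`n-1, n-2, …, n-k` (each merging its pending bag `P` and pending count `π` into those of its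
parent, a bundle `(q, P q ∪ P v)` being emitted and `q` reset as soon as the merged count reaches
`t`), the live vertices are `x < n - k` and: every live `x` roots its bag, bags are `par`-closed off
their roots, non-root members are dead, non-root parts of bags and emitted bundles are pairwise
disjoint, emitted bundles contain `≥ t` elements of `A`, pending counts are `< t` and dominated by
the bag's `A`-content, `#bundles · (2t-1) + Σ π ≥ |A|`, and the root of the last emitted bundle lies
in a live bag and in no bundle off its root. [cite: Hutchcroft2021, proof of Thm. 2.3 (p. 13)] -/
theorem bundling_aux (n t : ℕ) (ht : 1 ≤ t) (par : ℕ → ℕ) (hpar : ∀ i, 0 < i → par i < i)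
    (A : Finset ℕ) (hA : ∀ a ∈ A, a < n) :
    ∀ k, k < n →
    ∃ (P : ℕ → Finset ℕ) (π : ℕ → ℕ) (E : List (ℕ × Finset ℕ)),
      (∀ x, x < n - k → x ∈ P x) ∧
      (∀ x, x < n - k → ∀ y ∈ P x, y ≠ x → par y ∈ P x) ∧
      (∀ x, x < n - k → ∀ y ∈ P x, y ≠ x → n - k ≤ y ∧ y < n) ∧
      (∀ x x', x < n - k → x' < n - k → x ≠ x' → Disjoint ((P x).erase x) ((P x').erase x')) ∧
      (∀ x, x < n - k → ∀ B ∈ E, Disjoint ((P x).erase x) (B.2.erase B.1)) ∧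
      E.Pairwise (fun B B' => Disjoint (B.2.erase B.1) (B'.2.erase B'.1)) ∧
      (∀ B ∈ E, B.1 ∈ B.2 ∧ B.1 < n ∧ (∀ y ∈ B.2, y < n) ∧ (∀ y ∈ B.2, y ≠ B.1 → par y ∈ B.2) ∧
        (∀ y ∈ B.2, y ≠ B.1 → n - k ≤ y) ∧ t ≤ (B.2 ∩ A).card) ∧
      (∀ x, x < n - k → π x ≤ ((P x) ∩ A).card ∧ π x < t) ∧
      (A.card ≤ E.length * (2 * t - 1) + ∑ x ∈ range (n - k), π x) ∧
      (∀ B₀ rest, E = B₀ :: rest →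
        (∃ x, x < n - k ∧ B₀.1 ∈ P x) ∧ ∀ B ∈ E, B₀.1 ∉ B.2.erase B.1) := by
  intro k
  induction k with
  | zero =>
    intro hn
    simp only [Nat.sub_zero]
    by_cases ht1 : t = 1
    · -- every vertex of `A` is emitted at once as a singleton bundle
      subst ht1
      refine ⟨fun x => {x}, fun _ => 0, A.toList.map fun a => (a, {a}), ?_, ?_, ?_, ?_, ?_, ?_, ?_,
        ?_, ?_, ?_⟩
      · intro x _; exact mem_singleton_self x
      · intro x _ y hy hyx; exact absurd (mem_singleton.1 hy) hyx
      · intro x _ y hy hyx; exact absurd (mem_singleton.1 hy) hyx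
      · intro x x' _ _ _; simp
      · intro x _ B _; simp
      · rw [List.pairwise_map]
        exact List.pairwise_of_forall fun a b => by simp
      · intro B hB
        obtain ⟨a, ha, rfl⟩ := List.mem_map.1 hB
        rw [Finset.mem_toList] at ha
        refine ⟨mem_singleton_self a, hA a ha, fun y hy => ?_, fun y hy hya => ?_,
          fun y hy hya => ?_, ?_⟩
        · rw [mem_singleton.1 hy]; exact hA a ha
        · exact absurd (mem_singleton.1 hy) hya
        · exact absurd (mem_singleton.1 hy) hya
        · rw [singleton_inter_of_mem ha, card_singleton]
      · intro x _; simp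
      · simp
      · intro B₀ rest hE
        have hB₀ : B₀ ∈ A.toList.map fun a => (a, ({a} : Finset ℕ)) := by rw [hE]; simp
        obtain ⟨a, ha, rfl⟩ := List.mem_map.1 hB₀
        rw [Finset.mem_toList] at ha
        refine ⟨⟨a, hA a ha, mem_singleton_self a⟩, fun B hB => ?_⟩
        obtain ⟨b, _, rfl⟩ := List.mem_map.1 hB
        simp
    · -- `t ≥ 2`: nothing is emitted yet, each vertex carries its own weight
      have ht2 : 2 ≤ t := by omega
      refine ⟨fun x => {x}, fun x => if x ∈ A then 1 else 0, [], ?_, ?_, ?_, ?_, ?_, ?_, ?_, ?_,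
        ?_, ?_⟩
      · intro x _; exact mem_singleton_self x
      · intro x _ y hy hyx; exact absurd (mem_singleton.1 hy) hyx
      · intro x _ y hy hyx; exact absurd (mem_singleton.1 hy) hyx
      · intro x x' _ _ _; simp
      · intro x _ B hB; simp at hB
      · exact List.Pairwise.nil
      · intro B hB; simp at hB
      · intro x _
        dsimp only
        by_cases hx : x ∈ A
        · rw [if_pos hx, singleton_inter_of_mem hx, card_singleton]; omega
        · rw [if_neg hx]; omega
      · simp only [List.length_nil, zero_mul, zero_add]
        rw [Finset.sum_ite_mem, Finset.sum_const, smul_eq_mul, mul_one]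
        have : A ⊆ range n := fun a ha => mem_range.2 (hA a ha)
        rw [inter_eq_right.2 this]
      · intro B₀ rest hE; exact absurd hE (by simp)
  | succ k ih =>
    intro hkn
    obtain ⟨P, π, E, h1, h2, h3, h4, h5, h6, h7, h8, h9, h10⟩ := ih (Nat.lt_of_succ_lt hkn)
    -- process the vertex `v = n - k - 1 ≥ 1`, merging its bag into that of `q = par v`
    set v := n - (k + 1) with hv
    have hvj : n - k = v + 1 := by omega
    have hv1 : 1 ≤ v := by omega
    set q := par v with hq
    have hqv : q < v := hpar v (by omega)
    rw [hvj] at h1 h2 h3 h4 h5 h7 h8 h9 h10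
    have hvP : v ∈ P v := h1 v (by omega)
    have hqP : q ∈ P q := h1 q (by omega)
    -- the two bags are disjoint
    have hPqv : Disjoint (P q) (P v) := by
      rw [Finset.disjoint_left]
      intro y hyq hyv
      by_cases hyq' : y = q
      · subst hyq'
        have := (h3 v (by omega) _ hyv (by omega)).1
        omega
      by_cases hyv' : y = v
      · subst hyv'
        have := (h3 q (by omega) _ hyq hyq').1
        omega
      exact Finset.disjoint_left.1 (h4 q v (by omega) (by omega) (by omega))
        (mem_erase.2 ⟨hyq', hyq⟩) (mem_erase.2 ⟨hyv', hyv⟩)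
    have hcardU : ((P q ∪ P v) ∩ A).card = (P q ∩ A).card + (P v ∩ A).card := by
      rw [union_inter_distrib_right,
        card_union_of_disjoint (hPqv.mono inter_subset_left inter_subset_left)]
    by_cases hemit : t ≤ π q + π v
    · -- EMIT the bundle `(q, P q ∪ P v)` and reset `q`
      refine ⟨Function.update P q {q}, Function.update π q 0, (q, P q ∪ P v) :: E,
        ?_, ?_, ?_, ?_, ?_, ?_, ?_, ?_, ?_, ?_⟩
      · intro x hx
        by_cases hxq : x = q
        · subst hxq; simp
        · rw [Function.update_of_ne hxq]; exact h1 x (by omega)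
      · intro x hx y hy hyx
        by_cases hxq : x = q
        · subst hxq; simp at hy; exact absurd hy hyx
        · rw [Function.update_of_ne hxq] at hy ⊢; exact h2 x (by omega) y hy hyx
      · intro x hx y hy hyx
        by_cases hxq : x = q
        · subst hxq; simp at hy; exact absurd hy hyx
        · rw [Function.update_of_ne hxq] at hy
          have := h3 x (by omega) y hy hyx
          exact ⟨by omega, this.2⟩
      · intro x x' hx hx' hxx'
        by_cases hxq : x = q
        · subst hxq; simp
        by_cases hxq' : x' = q
        · subst hxq'; simp
        rw [Function.update_of_ne hxq, Function.update_of_ne hxq']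
        exact h4 x x' (by omega) (by omega) hxx'
      · intro x hx B hB
        by_cases hxq : x = q
        · subst hxq; simp
        rw [Function.update_of_ne hxq]
        rcases List.mem_cons.1 hB with rfl | hB
        · -- against the new bundle: `(P q ∪ P v).erase q ⊆ (P q).erase q ∪ P v`
          simp only
          rw [Finset.disjoint_left]
          intro y hy hy'
          rw [mem_erase, mem_union] at hy'
          obtain ⟨hyq, hy' | hy'⟩ := hy'
          · exact Finset.disjoint_left.1 (h4 x q (by omega) (by omega) hxq) hy
              (mem_erase.2 ⟨hyq, hy'⟩)
          · have hy1 := (h3 x (by omega) y (mem_of_mem_erase hy) (ne_of_mem_erase hy)).1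
            exact Finset.disjoint_left.1 (h4 x v (by omega) (by omega) (by omega)) hy
                (mem_erase.2 ⟨by omega, hy'⟩)
        · exact h5 x (by omega) B hB
      · rw [List.pairwise_cons]
        refine ⟨fun B hB => ?_, h6⟩
        simp only
        rw [Finset.disjoint_left]
        intro y hy hyB
        rw [mem_erase, mem_union] at hy
        obtain ⟨hyq, hy | hy⟩ := hy
        · exact Finset.disjoint_left.1 (h5 q (by omega) B hB) (mem_erase.2 ⟨hyq, hy⟩) hyB
        · have hy1 := (h7 B hB).2.2.2.2.1 y (mem_of_mem_erase hyB) (ne_of_mem_erase hyB)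
          exact Finset.disjoint_left.1 (h5 v (by omega) B hB) (mem_erase.2 ⟨by omega, hy⟩) hyB
      · intro B hB
        rcases List.mem_cons.1 hB with rfl | hB
        · simp only
          refine ⟨mem_union_left _ hqP, by omega, fun y hy => ?_, fun y hy hyq => ?_,
            fun y hy hyq => ?_, ?_⟩
          · rcases mem_union.1 hy with hy | hy
            · by_cases hyq : y = q
              · omega
              · exact (h3 q (by omega) y hy hyq).2
            · by_cases hyv : y = v
              · omega
              · exact (h3 v (by omega) y hy hyv).2
          · rcases mem_union.1 hy with hy | hy
            · exact mem_union_left _ (h2 q (by omega) y hy hyq)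
            · by_cases hyv : y = v
              · subst hyv; exact mem_union_left _ hqP
              · exact mem_union_right _ (h2 v (by omega) y hy hyv)
          · rcases mem_union.1 hy with hy | hy
            · have := (h3 q (by omega) y hy hyq).1; omega
            · by_cases hyv : y = v
              · omega
              · have := (h3 v (by omega) y hy hyv).1; omega
          · rw [hcardU]
            have hq8 := (h8 q (by omega)).1
            have hv8 := (h8 v (by omega)).1
            omega
        · obtain ⟨hB1, hB2, hB3, hB4, hB5, hB6⟩ := h7 B hB
          exact ⟨hB1, hB2, hB3, hB4, fun y hy hyB => le_of_lt (hB5 y hy hyB), hB6⟩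
      · intro x hx
        by_cases hxq : x = q
        · subst hxq; simp; omega
        · rw [Function.update_of_ne hxq, Function.update_of_ne hxq]; exact h8 x (by omega)
      · -- the count: one more bundle, the live weight drops by `π q + π v ≤ 2t - 2`
        rw [List.length_cons]
        have hsum : ∑ x ∈ range (v + 1), π x = π v + ∑ x ∈ range v, π x := by
          rw [Finset.sum_range_succ]; ring
        have hsum' : ∑ x ∈ range v, Function.update π q 0 x + π q = ∑ x ∈ range v, π x := by
          rw [← Finset.sum_erase_add _ _ (mem_range.2 hqv), Function.update_self, add_zero,
            ← Finset.sum_erase_add (range v) π (mem_range.2 hqv)]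
          congr 1
          exact Finset.sum_congr rfl fun x hx =>
            Function.update_of_ne (ne_of_mem_erase hx) _ _
        have hq8 := (h8 q (by omega)).2
        have hv8 := (h8 v (by omega)).2
        rw [hsum] at h9
        have : A.card + (π q + π v) ≤ (E.length + 1) * (2 * t - 1) +
            (∑ x ∈ range v, Function.update π q 0 x + π q + π v) := by
          rw [hsum', add_mul, one_mul]; omega
        omega
      · intro B₀ rest hE
        simp only [List.cons.injEq] at hE
        obtain ⟨rfl, rfl⟩ := hE
        refine ⟨⟨q, hqv, by simp⟩, fun B hB => ?_⟩
        rcases List.mem_cons.1 hB with rfl | hB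
        · simp
        · -- `q` is live, hence not a non-root member of an emitted bundle
          intro hq'
          have := (h7 B hB).2.2.2.2.1 q (mem_of_mem_erase hq') (ne_of_mem_erase hq')
          omega
    · -- NO emission: `q` absorbs the bag of `v`
      push Not at hemit
      refine ⟨Function.update P q (P q ∪ P v), Function.update π q (π q + π v), E,
        ?_, ?_, ?_, ?_, ?_, h6, ?_, ?_, ?_, ?_⟩
      · intro x hx
        by_cases hxq : x = q
        · subst hxq; simp [hqP]
        · rw [Function.update_of_ne hxq]; exact h1 x (by omega)
      · intro x hx y hy hyx
        by_cases hxq : x = q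
        · subst hxq
          rw [Function.update_self] at hy ⊢
          rcases mem_union.1 hy with hy | hy
          · exact mem_union_left _ (h2 q (by omega) y hy hyx)
          · by_cases hyv : y = v
            · subst hyv; exact mem_union_left _ hqP
            · exact mem_union_right _ (h2 v (by omega) y hy hyv)
        · rw [Function.update_of_ne hxq] at hy ⊢; exact h2 x (by omega) y hy hyx
      · intro x hx y hy hyx
        by_cases hxq : x = q
        · subst hxq
          rw [Function.update_self] at hy
          rcases mem_union.1 hy with hy | hy
          · have := h3 q (by omega) y hy hyx
            exact ⟨by omega, this.2⟩
          · by_cases hyv : y = v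
            · subst hyv; exact ⟨le_rfl, by omega⟩
            · have := h3 v (by omega) y hy hyv; exact ⟨by omega, this.2⟩
        · rw [Function.update_of_ne hxq] at hy
          have := h3 x (by omega) y hy hyx
          exact ⟨by omega, this.2⟩
      · intro x x' hx hx' hxx'
        -- the new bag of `q` is `(P q).erase q ∪ P v` off its root; all pieces were disjoint
        have key : ∀ z, z < v → z ≠ q →
            Disjoint ((P q ∪ P v).erase q) ((P z).erase z) := by
          intro z hz hzq
          rw [Finset.disjoint_left]
          intro y hy hy'
          rw [mem_erase, mem_union] at hy
          obtain ⟨hyq, hy | hy⟩ := hy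
          · exact Finset.disjoint_left.1 (h4 q z (by omega) (by omega) (Ne.symm hzq))
              (mem_erase.2 ⟨hyq, hy⟩) hy'
          · have hy1 := (h3 z (by omega) y (mem_of_mem_erase hy') (ne_of_mem_erase hy')).1
            exact Finset.disjoint_left.1 (h4 v z (by omega) (by omega) (by omega))
                (mem_erase.2 ⟨by omega, hy⟩) hy'
        by_cases hxq : x = q
        · subst hxq
          rw [Function.update_self, Function.update_of_ne (Ne.symm hxx')]
          exact key x' hx' (Ne.symm hxx')
        by_cases hxq' : x' = q
        · subst hxq'
          rw [Function.update_self, Function.update_of_ne hxq]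
          exact (key x hx hxq).symm
        rw [Function.update_of_ne hxq, Function.update_of_ne hxq']
        exact h4 x x' (by omega) (by omega) hxx'
      · intro x hx B hB
        by_cases hxq : x = q
        · subst hxq
          rw [Function.update_self, Finset.disjoint_left]
          intro y hy hyB
          rw [mem_erase, mem_union] at hy
          obtain ⟨hyq, hy | hy⟩ := hy
          · exact Finset.disjoint_left.1 (h5 q (by omega) B hB) (mem_erase.2 ⟨hyq, hy⟩) hyB
          · have hy1 := (h7 B hB).2.2.2.2.1 y (mem_of_mem_erase hyB) (ne_of_mem_erase hyB)
            exact Finset.disjoint_left.1 (h5 v (by omega) B hB) (mem_erase.2 ⟨by omega, hy⟩) hyB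
        · rw [Function.update_of_ne hxq]; exact h5 x (by omega) B hB
      · intro B hB
        obtain ⟨hB1, hB2, hB3, hB4, hB5, hB6⟩ := h7 B hB
        exact ⟨hB1, hB2, hB3, hB4, fun y hy hyB => le_of_lt (hB5 y hy hyB), hB6⟩
      · intro x hx
        by_cases hxq : x = q
        · subst hxq
          rw [Function.update_self, Function.update_self, hcardU]
          have hq8 := (h8 q (by omega)).1
          have hv8 := (h8 v (by omega)).1
          exact ⟨by omega, hemit⟩
        · rw [Function.update_of_ne hxq, Function.update_of_ne hxq]; exact h8 x (by omega)
      · have hsum : ∑ x ∈ range (v + 1), π x = π v + ∑ x ∈ range v, π x := by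
          rw [Finset.sum_range_succ]; ring
        have hsum' : ∑ x ∈ range v, Function.update π q (π q + π v) x =
            ∑ x ∈ range v, π x + π v := by
          rw [← Finset.sum_erase_add _ _ (mem_range.2 hqv), Function.update_self,
            ← Finset.sum_erase_add (range v) π (mem_range.2 hqv)]
          have : ∑ x ∈ (range v).erase q, Function.update π q (π q + π v) x =
              ∑ x ∈ (range v).erase q, π x :=
            Finset.sum_congr rfl fun x hx => Function.update_of_ne (ne_of_mem_erase hx) _ _
          rw [this]; ring
        rw [hsum] at h9
        rw [hsum']
        omega
      · intro B₀ rest hE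
        obtain ⟨⟨x, hx, hxB⟩, hrest⟩ := h10 B₀ rest hE
        refine ⟨?_, hrest⟩
        by_cases hxv : x = v
        · subst hxv
          refine ⟨q, hqv, ?_⟩
          rw [Function.update_self]
          exact mem_union_right _ hxB
        · refine ⟨x, by omega, ?_⟩
          by_cases hxq : x = q
          · subst hxq; rw [Function.update_self]; exact mem_union_left _ hxB
          · rw [Function.update_of_ne hxq]; exact hxB

/-- **Bundling lemma.** Let `0, …, n-1` carry a parent map with `par i < i` (`i ≥ 1`), let
`A ⊆ {0, …, n-1}` and `t ≥ 1`. Then there is a list of bundles `(r, U)` — `r ∈ U ⊆ {0,…,n-1}`,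
`U` closed under `par` off its root `r`, non-root members `≥ 1` — whose non-root parts
`U \ {r}` are pairwise disjoint, each containing at least `t` elements of `A`, at least
`(|A| + 1 - t)/(2t - 1)` in number, and the first of which (if any) is rooted at `0`. (Leaf-peeling
process of `bundling_aux`, with the final remainder merged into the last emitted bundle; our
substitute for Hutchcroft's `3`-adic Lemma 2.4.) [cite: Hutchcroft2021, Lemma 2.4 (p. 12)] -/
theorem exists_bundling (n t : ℕ) (hn : 1 ≤ n) (ht : 1 ≤ t) (par : ℕ → ℕ)
    (hpar : ∀ i, 0 < i → par i < i) (A : Finset ℕ) (hA : ∀ a ∈ A, a < n) :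
    ∃ F : List (ℕ × Finset ℕ),
      (∀ B ∈ F, B.1 ∈ B.2 ∧ (∀ y ∈ B.2, y < n) ∧ (∀ y ∈ B.2, y ≠ B.1 → par y ∈ B.2) ∧
        (∀ y ∈ B.2, y ≠ B.1 → 1 ≤ y) ∧ t ≤ (B.2 ∩ A).card) ∧
      F.Pairwise (fun B B' => Disjoint (B.2.erase B.1) (B'.2.erase B'.1)) ∧
      A.card + 1 ≤ F.length * (2 * t - 1) + t ∧
      (∀ B₀ rest, F = B₀ :: rest → B₀.1 = 0) := by
  obtain ⟨P, π, E, h1, h2, h3, h4, h5, h6, h7, h8, h9, h10⟩ :=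
    bundling_aux n t ht par hpar A hA (n - 1) (by omega)
  have hlive : n - (n - 1) = 1 := by omega
  rw [hlive] at h1 h2 h3 h4 h5 h7 h8 h9 h10
  have h0P : 0 ∈ P 0 := h1 0 one_pos
  rcases E with _ | ⟨B₀, rest⟩
  · refine ⟨[], by simp, List.Pairwise.nil, ?_, fun B₀ rest h => by simp at h⟩
    have := (h8 0 one_pos).2
    simp only [List.length_nil, zero_mul, zero_add, Finset.range_one, Finset.sum_singleton] at h9 ⊢
    omega
  · obtain ⟨⟨x, hx, hxB⟩, hroot⟩ := h10 B₀ rest rfl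
    have hx0 : x = 0 := by omega
    subst hx0
    refine ⟨(0, B₀.2 ∪ P 0) :: rest, ?_, ?_, ?_, ?_⟩
    · intro B hB
      rcases List.mem_cons.1 hB with rfl | hB
      · obtain ⟨hB1, -, hB3, hB4, -, hB6⟩ := h7 B₀ (by simp)
        simp only
        refine ⟨mem_union_right _ h0P, fun y hy => ?_, fun y hy hy0 => ?_, fun y _ hy0 => by omega,
          ?_⟩
        · rcases mem_union.1 hy with hy | hy
          · exact hB3 y hy
          · by_cases hy0 : y = 0
            · omega
            · exact (h3 0 one_pos y hy hy0).2
        · rcases mem_union.1 hy with hy | hy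
          · by_cases hyr : y = B₀.1
            · subst hyr; exact mem_union_right _ (h2 0 one_pos _ hxB hy0)
            · exact mem_union_left _ (hB4 y hy hyr)
          · exact mem_union_right _ (h2 0 one_pos y hy hy0)
        · exact le_trans hB6 (card_le_card (inter_subset_inter_right subset_union_left))
      · obtain ⟨hB1, hB2, hB3, hB4, hB5, hB6⟩ := h7 B (by simp [hB])
        exact ⟨hB1, hB3, hB4, fun y hy hyB => hB5 y hy hyB, hB6⟩
    · rw [List.pairwise_cons] at h6 ⊢
      refine ⟨fun B hB => ?_, h6.2⟩
      simp only
      rw [Finset.disjoint_left]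
      intro y hy hyB
      rw [mem_erase, mem_union] at hy
      obtain ⟨hy0, hy | hy⟩ := hy
      · by_cases hyr : y = B₀.1
        · subst hyr; exact hroot B (by simp [hB]) hyB
        · exact Finset.disjoint_left.1 (h6.1 B hB) (mem_erase.2 ⟨hyr, hy⟩) hyB
      · exact Finset.disjoint_left.1 (h5 0 one_pos B (by simp [hB])) (mem_erase.2 ⟨hy0, hy⟩) hyB
    · have := (h8 0 one_pos).2
      simp only [List.length_cons, Finset.range_one, Finset.sum_singleton] at h9 ⊢
      omega
    · intro B rest' h
      simp only [List.cons.injEq] at h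
      obtain ⟨rfl, -⟩ := h
      rfl

/-! ### A connected ordering of a finite connected set -/

/-- Along a walk from a vertex of `U` to a vertex outside `U` some edge exits `U`. [folklore] -/
theorem Walk.exists_adj_exit {V : Type*} {G : SimpleGraph V} (U : Set V) :
    ∀ {a b : V} (w : G.Walk a b), a ∈ U → b ∉ U →
      ∃ c d, c ∈ U ∧ d ∉ U ∧ G.Adj c d ∧ c ∈ w.support ∧ d ∈ w.support
  | _, _, SimpleGraph.Walk.nil, ha, hb => absurd ha hb
  | a, b, SimpleGraph.Walk.cons (v := a') hadj w, ha, hb => by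
    by_cases ha' : a' ∈ U
    · obtain ⟨c, d, hc, hd, hcd, hcw, hdw⟩ := Walk.exists_adj_exit U w ha' hb
      exact ⟨c, d, hc, hd, hcd, by simp [hcw], by simp [hdw]⟩
    · exact ⟨a, a', ha, ha', hadj, by simp, by simp [w.start_mem_support]⟩

/-- **Connected ordering.** A finite set `T` every vertex of which is joined to `x ∈ T` by a walk
inside `T` can be listed without repetition starting from `x` so that every later vertex is
adjacent to an earlier one (grow the list one boundary vertex at a time). [folklore] -/
theorem exists_adjacent_ordering {V : Type*} [DecidableEq V] (G : SimpleGraph V) (T : Finset V)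
    (x : V) (hx : x ∈ T) (hT : ∀ y ∈ T, ∃ w : G.Walk x y, ∀ z ∈ w.support, z ∈ T) :
    ∃ L : List V, L.Nodup ∧ (∀ y, y ∈ L ↔ y ∈ T) ∧ L.head? = some x ∧
      ∀ i, ∀ hi : i < L.length, 0 < i → ∃ j, ∃ hj : j < i, G.Adj (L[j]'(hj.trans hi)) (L[i]'hi) := by
  -- prefixes of every length `k ≤ |T|`
  have key : ∀ k, k ≤ T.card → ∃ L : List V, L.Nodup ∧ L.length = k ∧ (∀ y ∈ L, y ∈ T) ∧
      (0 < k → L.head? = some x) ∧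
      ∀ i, ∀ hi : i < L.length, 0 < i → ∃ j, ∃ hj : j < i, G.Adj (L[j]'(hj.trans hi)) (L[i]'hi) := by
    intro k
    induction k with
    | zero => intro _; exact ⟨[], List.nodup_nil, rfl, by simp, by simp, by simp⟩
    | succ k ih =>
      intro hk
      obtain ⟨L, hnd, hlen, hsub, hhead, hadj⟩ := ih (Nat.le_of_succ_le hk)
      rcases Nat.eq_zero_or_pos k with rfl | hkpos
      · -- start with `x`
        have hL : L = [] := List.eq_nil_of_length_eq_zero hlen
        subst hL
        refine ⟨[x], List.nodup_singleton x, rfl, by simpa using hx, by simp, ?_⟩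
        intro i hi hi0; simp at hi; omega
      · -- find a vertex of `T` outside `L` adjacent to a vertex of `L`
        have hcard : L.toFinset.card < T.card := by
          rw [List.toFinset_card_of_nodup hnd, hlen]; omega
        obtain ⟨y₀, hy₀T, hy₀L⟩ : ∃ y₀ ∈ T, y₀ ∉ L.toFinset := by
          by_contra hcon
          push Not at hcon
          exact absurd (card_le_card hcon) (not_le.2 hcard)
        obtain ⟨w, hw⟩ := hT y₀ hy₀T
        have hxL : x ∈ L := by
          have := hhead hkpos
          exact List.mem_of_mem_head? this
        obtain ⟨c, d, hc, hd, hcd, -, hdw⟩ :=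
          Walk.exists_adj_exit (U := {z | z ∈ L}) w hxL (by simpa using hy₀L)
        simp only [Set.mem_setOf_eq] at hc hd
        refine ⟨L ++ [d], ?_, by simp [hlen], ?_, ?_, ?_⟩
        · exact List.nodup_append.2 ⟨hnd, List.nodup_singleton d, fun a ha b hb => by
            simp only [List.mem_singleton] at hb; rintro rfl; exact hd (hb ▸ ha)⟩
        · intro y hy
          rcases List.mem_append.1 hy with hy | hy
          · exact hsub y hy
          · simp at hy; rw [hy]; exact hw d hdw
        · intro _
          rcases L with _ | ⟨a, L'⟩
          · simp at hlen; omega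
          · simpa using hhead hkpos
        · intro i hi hi0
          simp only [List.length_append, List.length_singleton] at hi
          by_cases hil : i < L.length
          · obtain ⟨j, hj, hadj'⟩ := hadj i hil hi0
            refine ⟨j, hj, ?_⟩
            rwa [List.getElem_append_left (hj.trans hil), List.getElem_append_left hil]
          · have hiL : i = L.length := by omega
            obtain ⟨j, hj, rfl⟩ := List.getElem_of_mem hc
            refine ⟨j, by omega, ?_⟩
            rw [List.getElem_append_left hj, List.getElem_append_right (by omega)]
            simpa [hiL] using hcd
  obtain ⟨L, hnd, hlen, hsub, hhead, hadj⟩ := key T.card le_rfl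
  refine ⟨L, hnd, fun y => ⟨hsub y, fun hy => ?_⟩, hhead (card_pos.2 ⟨x, hx⟩), hadj⟩
  -- `L ⊆ T` with `|L| = |T|`
  have hTL : L.toFinset = T := eq_of_subset_of_card_le (fun y hy => hsub y (List.mem_toFinset.1 hy))
    (by rw [List.toFinset_card_of_nodup hnd, hlen])
  rw [← hTL, List.mem_toFinset] at hy
  exact hy

/-! ### Disjoint open witnesses of a large cluster -/

/-- In the graph whose open edges are the parent edges `{u i, u (par i)}`, `i ∈ U \ {r}`, of a
`par`-closed bundle `U` with root `r`, every `u i`, `i ∈ U`, is joined to `u r`. [folklore] -/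
theorem reachable_of_parClosed {V : Type*} [DecidableEq V] (u : ℕ → V) (par : ℕ → ℕ)
    (hpar : ∀ i, 0 < i → par i < i) (n : ℕ) (hu : ∀ i j, i < n → j < n → u i = u j → i = j)
    (r : ℕ) (U : Finset ℕ) (hUn : ∀ y ∈ U, y < n) (hclosed : ∀ y ∈ U, y ≠ r → par y ∈ U)
    (hpos : ∀ y ∈ U, y ≠ r → 1 ≤ y) :
    ∀ i ∈ U, (openGraph (↑((U.erase r).image fun i => s(u i, u (par i))) : Set (Sym2 V))).Reachable
      (u r) (u i) := by
  intro i
  induction i using Nat.strong_induction_on with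
  | _ i ih =>
    intro hi
    by_cases hir : i = r
    · rw [hir]
    · have hp := hclosed i hi hir
      have hlt := hpar i (hpos i hi hir)
      refine (ih (par i) hlt hp).trans (SimpleGraph.Adj.reachable ?_)
      rw [openGraph_adj]
      refine ⟨?_, fun h => ?_⟩
      · rw [Finset.mem_coe, Sym2.eq_swap]
        exact mem_image.2 ⟨i, mem_erase.2 ⟨hir, hi⟩, rfl⟩
      · have := hu _ _ (lt_trans hlt (hUn i hi)) (hUn i hi) h
        omega

open Classical in
/-- **Disjoint open witnesses of a large cluster.** If the open cluster of `x` in `ω` contains a set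
`S ⊆ Λ` of at least `(2N+1)t` vertices (`t ≥ 1`), then there are `N + 1` pairwise disjoint finite
sets of `ω`-open edges, each of which alone connects at least `t` vertices of `Λ` to a single
vertex, the first of them to `x` itself. (Connected ordering of the union of open paths from `x` to
`S`, then `exists_bundling` on the parent forest; each bundle contributes its parent edges.)
[cite: Hutchcroft2021, proof of Thm. 2.3 (disjoint witnesses from Lemma 2.4)] -/
theorem exists_disjoint_cluster_witnesses {V : Type*} [DecidableEq V] (ω : BondConfig V)
    (Λ : Finset V) (x : V) (N t : ℕ) (ht : 1 ≤ t) (S : Finset V)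
    (hS : ∀ y ∈ S, y ∈ Λ ∧ (openGraph ω).Reachable x y) (hcard : (2 * N + 1) * t ≤ S.card) :
    ∃ W : List (Finset (Sym2 V)),
      W.length = N + 1 ∧
      (∀ F ∈ W, (↑F : Set (Sym2 V)) ⊆ ω) ∧
      W.Pairwise (fun F F' => Disjoint F F') ∧
      (∀ F ∈ W, ∃ y : V,
        t ≤ (Λ.filter fun z => (openGraph (↑F : Set (Sym2 V))).Reachable y z).card) ∧
      (∀ F rest, W = F :: rest →
        t ≤ (Λ.filter fun z => (openGraph (↑F : Set (Sym2 V))).Reachable x z).card) := by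
  classical
  -- Step 1: a finite set `T ∋ x` containing `S`, connected from `x` inside `T`
  set G := openGraph ω with hG
  have hwalk : ∀ s : S, ∃ _w : G.Walk x s, True := fun s => ⟨(hS s s.2).2.some, trivial⟩
  choose wk _hwk using hwalk
  set T : Finset V := insert x (Finset.univ.biUnion fun s : S => (wk s).support.toFinset) with hT
  have hxT : x ∈ T := mem_insert_self _ _
  have hST : S ⊆ T := by
    intro s hs
    refine mem_insert_of_mem (mem_biUnion.2 ⟨⟨s, hs⟩, mem_univ _, ?_⟩)
    rw [List.mem_toFinset]; exact (wk ⟨s, hs⟩).end_mem_support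
  have hTconn : ∀ y ∈ T, ∃ w : G.Walk x y, ∀ z ∈ w.support, z ∈ T := by
    intro y hy
    rcases mem_insert.1 hy with rfl | hy
    · exact ⟨SimpleGraph.Walk.nil, fun z hz => by simp at hz; rw [hz]; exact hxT⟩
    · obtain ⟨s, -, hys⟩ := mem_biUnion.1 hy
      rw [List.mem_toFinset] at hys
      refine ⟨(wk s).takeUntil y hys, fun z hz => ?_⟩
      have := (wk s).support_takeUntil_subset_support hys hz
      exact mem_insert_of_mem (mem_biUnion.2 ⟨s, mem_univ _, List.mem_toFinset.2 this⟩)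
  -- Step 2: a connected ordering of `T`, vertices `u i` and parents `par i` by index
  obtain ⟨L, hnd, hLT, hhead, hadj⟩ := exists_adjacent_ordering G T x hxT hTconn
  set n := L.length with hn
  have hn1 : 1 ≤ n := by
    rcases L with _ | ⟨a, L'⟩
    · simp at hhead
    · simp [hn]
  set u : ℕ → V := fun i => if h : i < n then L[i]'h else x with hu
  have hu_eq : ∀ i (h : i < n), u i = L[i] := fun i h => by simp [hu, h]
  have hu0 : u 0 = x := by
    rw [hu_eq 0 (by omega)]
    rcases L with _ | ⟨a, L'⟩
    · simp at hhead
    · simpa using hhead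
  have hu_inj : ∀ i j, i < n → j < n → u i = u j → i = j := by
    intro i j hi hj h
    rw [hu_eq i hi, hu_eq j hj] at h
    exact (List.Nodup.getElem_inj_iff hnd).1 h
  have hpar_ex : ∀ i, 0 < i → i < n → ∃ j, j < i ∧ G.Adj (u j) (u i) := by
    intro i hi0 hi
    obtain ⟨j, hj, hadj'⟩ := hadj i hi hi0
    exact ⟨j, hj, by rwa [hu_eq j (hj.trans hi), hu_eq i hi]⟩
  choose! parf hparf_lt hparf_adj using hpar_ex
  set par : ℕ → ℕ := fun i => if 0 < i ∧ i < n then parf i else 0 with hpar_def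
  have hpar : ∀ i, 0 < i → par i < i := by
    intro i hi
    simp only [hpar_def]
    split_ifs with h
    · exact hparf_lt i h.1 h.2
    · exact hi
  have hpar_adj : ∀ i, 0 < i → i < n → G.Adj (u (par i)) (u i) := by
    intro i hi0 hi
    simp only [hpar_def, hi0, hi, and_self, if_true]
    exact hparf_adj i hi0 hi
  -- Step 3: bundle the indices of the `Λ`-vertices
  set A : Finset ℕ := (range n).filter fun i => u i ∈ Λ with hA_def
  have hA : ∀ a ∈ A, a < n := fun a ha => mem_range.1 (mem_filter.1 ha).1
  have hAcard : S.card ≤ A.card := by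
    have : S ⊆ A.image u := by
      intro s hs
      have hsT : s ∈ L := (hLT s).2 (hST hs)
      obtain ⟨i, hi, his⟩ := List.getElem_of_mem hsT
      refine mem_image.2 ⟨i, mem_filter.2 ⟨mem_range.2 hi, ?_⟩, by rw [hu_eq i hi, his]⟩
      rw [hu_eq i hi, his]; exact (hS _ hs).1
    exact le_trans (card_le_card this) card_image_le
  obtain ⟨F, hF, hFdisj, hFcount, hFroot⟩ := exists_bundling n t hn1 ht par hpar A hA
  have hFlen : N + 1 ≤ F.length := by
    by_contra hlt
    push Not at hlt
    have h1 : F.length * (2 * t - 1) ≤ N * (2 * t - 1) := Nat.mul_le_mul_right _ (by omega)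
    have h2 : N * (2 * t - 1) + N = N * (2 * t) := by
      rw [← Nat.mul_succ]; congr 1; omega
    have h3 : (2 * N + 1) * t = N * (2 * t) + t := by ring
    omega
  -- Step 4: the witnesses are the parent edges of the first `N + 1` bundles
  set edges : ℕ × Finset ℕ → Finset (Sym2 V) :=
    fun B => (B.2.erase B.1).image fun i => s(u i, u (par i)) with hedges
  have htake : ∀ B ∈ F.take (N + 1), B ∈ F := fun B hB => List.mem_of_mem_take hB
  refine ⟨(F.take (N + 1)).map edges, ?_, ?_, ?_, ?_, ?_⟩
  · rw [List.length_map, List.length_take]; omega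
  · intro E hE
    obtain ⟨B, hB, rfl⟩ := List.mem_map.1 hE
    obtain ⟨-, hBn, -, hBpos, -⟩ := hF B (htake B hB)
    intro e he
    rw [Finset.mem_coe, hedges, mem_image] at he
    obtain ⟨i, hi, rfl⟩ := he
    have hi1 := hBpos i (mem_of_mem_erase hi) (ne_of_mem_erase hi)
    have := hpar_adj i hi1 (hBn i (mem_of_mem_erase hi))
    rw [hG, openGraph_adj] at this
    rw [Sym2.eq_swap]; exact this.1
  · rw [List.pairwise_map]
    refine (List.Pairwise.sublist (List.take_sublist (N + 1) F) hFdisj).imp_of_mem ?_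
    intro B B' hB hB' hBB'
    obtain ⟨-, hBn, -, hBpos, -⟩ := hF B (htake B hB)
    obtain ⟨-, hBn', -, hBpos', -⟩ := hF B' (htake B' hB')
    rw [Finset.disjoint_left]
    intro e he he'
    simp only [hedges, mem_image] at he he'
    obtain ⟨i, hi, rfl⟩ := he
    obtain ⟨i', hi', heq⟩ := he'
    have hin := hBn i (mem_of_mem_erase hi)
    have hi'n := hBn' i' (mem_of_mem_erase hi')
    have hpi := hpar i (hBpos i (mem_of_mem_erase hi) (ne_of_mem_erase hi))
    have hpi' := hpar i' (hBpos' i' (mem_of_mem_erase hi') (ne_of_mem_erase hi'))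
    rcases Sym2.eq_iff.1 heq with ⟨h1, -⟩ | ⟨h1, h2⟩
    · have hii' : i' = i := hu_inj i' i hi'n hin h1
      subst hii'
      exact Finset.disjoint_left.1 hBB' hi hi'
    · have e1 : i' = par i := hu_inj _ _ hi'n (lt_trans hpi hin) h1
      have e2 : par i' = i := hu_inj _ _ (lt_trans hpi' hi'n) hin h2
      omega
  · intro E hE
    obtain ⟨B, hB, rfl⟩ := List.mem_map.1 hE
    obtain ⟨hBr, hBn, hBcl, hBpos, hBt⟩ := hF B (htake B hB)
    refine ⟨u B.1, le_trans hBt ?_⟩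
    have hreach := reachable_of_parClosed u par hpar n hu_inj B.1 B.2 hBn hBcl hBpos
    calc (B.2 ∩ A).card = ((B.2 ∩ A).image u).card := by
          rw [card_image_of_injOn]
          intro i hi j hj hij
          exact hu_inj i j (hBn i (mem_of_mem_inter_left hi)) (hBn j (mem_of_mem_inter_left hj)) hij
      _ ≤ _ := card_le_card fun z hz => ?_
    obtain ⟨i, hi, rfl⟩ := mem_image.1 hz
    exact mem_filter.2 ⟨(mem_filter.1 (mem_of_mem_inter_right hi)).2,
      hreach i (mem_of_mem_inter_left hi)⟩
  · intro E rest hE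
    rcases F with _ | ⟨B₀, F'⟩
    · simp at hE
    · simp only [List.take_succ_cons, List.map_cons, List.cons.injEq] at hE
      obtain ⟨rfl, -⟩ := hE
      have hB0 : B₀.1 = 0 := hFroot B₀ F' rfl
      obtain ⟨hBr, hBn, hBcl, hBpos, hBt⟩ := hF B₀ (by simp)
      have hreach := reachable_of_parClosed u par hpar n hu_inj B₀.1 B₀.2 hBn hBcl hBpos
      rw [hB0, hu0] at hreach
      refine le_trans hBt ?_
      calc (B₀.2 ∩ A).card = ((B₀.2 ∩ A).image u).card := by
            rw [card_image_of_injOn]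
            intro i hi j hj hij
            exact hu_inj i j (hBn i (mem_of_mem_inter_left hi)) (hBn j (mem_of_mem_inter_left hj)) hij
        _ ≤ _ := card_le_card fun z hz => ?_
      obtain ⟨i, hi, rfl⟩ := mem_image.1 hz
      refine mem_filter.2 ⟨(mem_filter.1 (mem_of_mem_inter_right hi)).2, ?_⟩
      have := hreach i (mem_of_mem_inter_left hi)
      simpa only [hedges, hB0] using this

end Literature.Probability.Percolation
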